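import Summits.CriticalPhenomena.SAWScalingLimit.Theorems.DefectDecoherence.Negative.WallExitTwoPoint
import Summits.CriticalPhenomena.SAWScalingLimit.Theorems.MassRatio.Negative.Tools
import Literature.Probability.LatticeModels.TriangularLatticeProofs
import HarnessLib

/-!
# Finite-sum and lattice bookkeeping for the conjugate-class average of the SAW parafermion

Route `SAWDefectDecoherence` of `CriticalPhenomena/SAWScalingLimit`; helper file for the node
`ConjugateClassNegligible` (item `stmt-CriticalPhenomena-8551`) and the glue `DecoherenceSynthesis`
(item `stmt-CriticalPhenomena-8558`), consumed by
`Theorems/SAWDefectDecoherenceConjugateClassNegligible.lean`.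

Contents (namespace `Summit.CriticalPhenomena.SAWScalingLimit.Theorems.ConjugateClassNegligibleSynthesis`):
* honeycomb geometry: `‖c_t - c_v‖ ≤ 1` (from `dist_hexCenter_le_one_of_adj` of
  `Theorems/DefectDecoherence/Negative/WallExitTwoPoint.lean`), `mid{v,t} - c_v = (c_t - c_v)/2`,
  bipartiteness; finiteness of `hexDomainMidEdges Λ` is `hexDomainMidEdges_finite` of
  `Theorems/MassRatio/Negative/Tools.lean` (both reused, not restated);
* the observable: `‖F_{x,σ}(z)‖ ≤ ‖F_{x,0}(z)‖`, and `‖F_{x,σ}(z)‖ = ‖F_{x,0}(z)‖` when all walks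
  `a → z` have the same winding (boundary rigidity ⇒ `|F(b)| = Z(b)`);
* the `finsum` over the black→white ordered pairs `{p | s(p.1,p.2) ∈ hexDomainMidEdges Λ ∧ p.1.2 = 0}`
  of the statement of `ConjugateClassNegligible` as an iterated `Finset` sum over black vertices of
  `Λ` and their neighbours in `Λ` (`finsum_pairSet_eq`), and the comparison of nonnegative pair sums
  with the `finsum` over mid-edges of the statement of `MassRatio` (`sum_pair_indicator_le_finsum`);
* metric bookkeeping at scale `δ` (`dist_mid_center_le`).
-/

noncomputable section

open scoped BigOperators
open Set Metric
open Literature.Probability.LatticeModels Literature.Probability.RandomPlanarGeometry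
open Literature.Probability.RandomPlanarGeometry.SAW
open Summit.CriticalPhenomena.SAWScalingLimit.Cruxes.DefectDecoherence.TipMartingaleDepthInduction.WallExitTwoPoint
  (dist_hexCenter_le_one_of_adj)
open Summit.CriticalPhenomena.SAWScalingLimit.Theorems.MassRatio.Negative (hexDomainMidEdges_finite)

namespace Summit.CriticalPhenomena.SAWScalingLimit.Theorems.ConjugateClassNegligibleSynthesis

/-! ### Lattice geometry -/

/-- The honeycomb edge vector has norm `≤ 1` (it equals `1/√3`). [folklore] -/
theorem norm_hexCenter_sub_le_one {v t : HexVertex} (h : hexGraph.Adj v t) :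
    ‖hexCenter t - hexCenter v‖ ≤ 1 := by
  rw [← dist_eq_norm]; exact dist_hexCenter_le_one_of_adj h

/-- `mid{v,t} - c_v = (c_t - c_v)/2`. [folklore] -/
theorem hexMidpoint_sub_hexCenter (v t : HexVertex) :
    hexMidpoint s(v, t) - hexCenter v = (hexCenter t - hexCenter v) / 2 := by
  rw [hexMidpoint_mk]; ring

/-- `c_t - mid{v,t} = (c_t - c_v)/2`. [folklore] -/
theorem hexCenter_sub_hexMidpoint (v t : HexVertex) :
    hexCenter t - hexMidpoint s(v, t) = (hexCenter t - hexCenter v) / 2 := by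
  rw [hexMidpoint_mk]; ring

/-- `‖mid{v,t} - c_v‖ ≤ 1/2` for `t ∼ v`. [folklore] -/
theorem norm_hexMidpoint_sub_hexCenter_le {v t : HexVertex} (h : hexGraph.Adj v t) :
    ‖hexMidpoint s(v, t) - hexCenter v‖ ≤ 1 / 2 := by
  rw [hexMidpoint_sub_hexCenter, norm_div, Complex.norm_two]
  linarith [norm_hexCenter_sub_le_one h]

/-- `‖c_t - mid{v,t}‖ ≤ 1/2` for `t ∼ v`. [folklore] -/
theorem norm_hexCenter_sub_hexMidpoint_le {v t : HexVertex} (h : hexGraph.Adj v t) :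
    ‖hexCenter t - hexMidpoint s(v, t)‖ ≤ 1 / 2 := by
  rw [hexCenter_sub_hexMidpoint, norm_div, Complex.norm_two]
  linarith [norm_hexCenter_sub_le_one h]

/-- The honeycomb lattice is bipartite: a neighbour of a black vertex is white. [folklore] -/
theorem snd_ne_of_adj {v t : HexVertex} (h : hexGraph.Adj v t) : v.2 ≠ t.2 :=
  fun he => not_hexGraph_adj_of_snd_eq_holds v t he h

/-! ### The observable: spin-free domination and boundary rigidity -/

/-- `‖F_{x,σ}(z)‖ ≤ ‖F_{x,0}(z)‖` for `x ≥ 0`: the spin-`0` observable is the walk generating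
function, which dominates every spin by the triangle inequality. [folklore] -/
theorem norm_obs_le_norm_obs_zero (Λ : Finset HexVertex) (a : Sym2 HexVertex) {x : ℝ}
    (hx : 0 ≤ x) (σ : ℝ) (z : Sym2 HexVertex) :
    ‖hexParafermionicObservable Λ a x σ z‖ ≤ ‖hexParafermionicObservable Λ a x 0 z‖ := by
  refine (norm_hexParafermionicObservable_le Λ a hx σ z).trans (le_of_eq ?_)
  rw [hexParafermionicObservable_zero_spin, Complex.norm_real, Real.norm_of_nonneg]
  exact Finset.sum_nonneg fun γ _ => pow_nonneg hx _

/-- If all walks `a → z` have the same winding, the observable at `z` has the modulus of the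
generating function: `‖F_{x,σ}(z)‖ = ‖F_{x,0}(z)‖` (`x ≥ 0`). [folklore] -/
theorem norm_obs_eq_of_winding_eq (Λ : Finset HexVertex) (a z : Sym2 HexVertex) (x : ℝ)
    (σ : ℝ) (h : ∀ γ γ' : HexMidEdgeSAW Λ a z, γ.winding = γ'.winding) :
    ‖hexParafermionicObservable Λ a x σ z‖ = ‖hexParafermionicObservable Λ a x 0 z‖ := by
  rcases isEmpty_or_nonempty (HexMidEdgeSAW Λ a z) with hE | ⟨⟨γ₀⟩⟩
  · simp [hexParafermionicObservable]
  · have key : hexParafermionicObservable Λ a x σ z =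
        Complex.exp (-Complex.I * σ * (γ₀.winding : ℝ)) * hexParafermionicObservable Λ a x 0 z := by
      rw [hexParafermionicObservable, hexParafermionicObservable, Finset.mul_sum]
      refine Finset.sum_congr rfl fun γ _ => ?_
      rw [HexMidEdgeSAW.weight, HexMidEdgeSAW.weight_zero_spin, h γ γ₀]
    rw [key, norm_mul, Complex.norm_exp]
    have : (-Complex.I * (σ : ℂ) * ((γ₀.winding : ℝ) : ℂ)).re = 0 := by
      simp [Complex.mul_re, Complex.mul_im]
    rw [this, Real.exp_zero, one_mul]

/-! ### Finite sums over black→white pairs and over mid-edges -/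

/-- Membership in the `Finset` of black→white pairs `(v, t)`, `v, t ∈ Λ`, `v` black, `v ∼ t`.
[folklore] -/
theorem mem_pairFinset {Λ : Finset HexVertex} {p : HexVertex × HexVertex} :
    p ∈ (((Λ.filter fun v => v.2 = 0) ×ˢ Λ).filter fun p => hexGraph.Adj p.1 p.2) ↔ p.1 ∈ Λ ∧ p.1.2 = 0 ∧ p.2 ∈ Λ ∧ hexGraph.Adj p.1 p.2 := by
  simp only [Finset.mem_filter, Finset.mem_product, and_assoc]

/-- The black→white pairs inside `Λ` belong to the pair set of the statement. [folklore] -/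
theorem pairFinset_subset_pairSet (Λ : Finset HexVertex) :
    (↑(((Λ.filter fun v => v.2 = 0) ×ˢ Λ).filter fun p => hexGraph.Adj p.1 p.2) : Set (HexVertex × HexVertex)) ⊆ {p : HexVertex × HexVertex | s(p.1, p.2) ∈ hexDomainMidEdges Λ ∧ p.1.2 = 0} := by
  intro p hp
  rw [Finset.mem_coe, mem_pairFinset] at hp
  obtain ⟨h1, hb, -, hadj⟩ := hp
  exact ⟨⟨(SimpleGraph.mem_edgeSet _).2 hadj, p.1, Sym2.mem_mk_left _ _, h1⟩, hb⟩

/-- A sum over the black→white pairs inside `Λ` is the iterated sum over black vertices and their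
neighbours in `Λ`. [folklore] -/
theorem sum_pairFinset_eq {M : Type*} [AddCommMonoid M] (Λ : Finset HexVertex)
    (f : HexVertex × HexVertex → M) :
    ∑ p ∈ (((Λ.filter fun v => v.2 = 0) ×ˢ Λ).filter fun p => hexGraph.Adj p.1 p.2), f p =
      ∑ v ∈ Λ.filter (fun v => v.2 = 0), ∑ t ∈ Λ.filter (fun t => hexGraph.Adj v t), f (v, t) := by
  rw [Finset.sum_filter, Finset.sum_product]
  refine Finset.sum_congr rfl fun v _ => ?_
  rw [Finset.sum_filter]

/-- If the summand vanishes off the pairs with both ends in `Λ`, the `finsum` over the pair set of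
the statement is the iterated finite sum over black vertices of `Λ` and their neighbours in `Λ`. [folklore] -/
theorem finsum_pairSet_eq {M : Type*} [AddCommMonoid M] (Λ : Finset HexVertex)
    (f : HexVertex × HexVertex → M)
    (hf : ∀ p ∈ {p : HexVertex × HexVertex | s(p.1, p.2) ∈ hexDomainMidEdges Λ ∧ p.1.2 = 0}, f p ≠ 0 → p.1 ∈ Λ ∧ p.2 ∈ Λ) :
    ∑ᶠ p ∈ {p : HexVertex × HexVertex | s(p.1, p.2) ∈ hexDomainMidEdges Λ ∧ p.1.2 = 0}, f p =
      ∑ v ∈ Λ.filter (fun v => v.2 = 0), ∑ t ∈ Λ.filter (fun t => hexGraph.Adj v t), f (v, t) := by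
  rw [← sum_pairFinset_eq]
  refine finsum_mem_eq_sum_of_subset f ?_ (pairFinset_subset_pairSet Λ)
  intro p hp
  obtain ⟨hpS, hpf⟩ := hp
  obtain ⟨h1, h2⟩ := hf p hpS hpf
  rw [Finset.mem_coe, mem_pairFinset]
  exact ⟨h1, hpS.2, h2, (SimpleGraph.mem_edgeSet _).1 hpS.1.1⟩

/-- The map `(v, t) ↦ {v, t}` is injective on black→white pairs. [folklore] -/
theorem injOn_sym2_pairFinset (Λ : Finset HexVertex) :
    Set.InjOn (fun p : HexVertex × HexVertex => s(p.1, p.2)) ↑(((Λ.filter fun v => v.2 = 0) ×ˢ Λ).filter fun p => hexGraph.Adj p.1 p.2) := by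
  intro p hp q hq hpq
  rw [Finset.mem_coe, mem_pairFinset] at hp hq
  rcases Sym2.eq_iff.1 hpq with ⟨h1, h2⟩ | ⟨h1, h2⟩
  · exact Prod.ext h1 h2
  · exfalso
    have := snd_ne_of_adj hq.2.2.2
    rw [hq.2.1, ← h1, hp.2.1] at this
    exact this rfl

/-- A nonnegative function summed over the black→white pairs whose edge satisfies `P` is at most
its `finsum` over all domain mid-edges satisfying `P` (each edge has one black end). [folklore] -/
theorem sum_pair_indicator_le_finsum (Λ : Finset HexVertex) (g : Sym2 HexVertex → ℝ)
    (hg : ∀ e, 0 ≤ g e) (P : Sym2 HexVertex → Prop) [DecidablePred P] :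
    ∑ v ∈ Λ.filter (fun v => v.2 = 0), ∑ t ∈ Λ.filter (fun t => hexGraph.Adj v t),
        (if P s(v, t) then g s(v, t) else 0) ≤
      ∑ᶠ e ∈ {e | e ∈ hexDomainMidEdges Λ ∧ P e}, g e := by
  classical
  have hfin : {e | e ∈ hexDomainMidEdges Λ ∧ P e}.Finite :=
    (hexDomainMidEdges_finite Λ).subset fun e he => he.1
  rw [finsum_mem_eq_finite_toFinset_sum g hfin,
    ← sum_pairFinset_eq Λ (fun p => if P s(p.1, p.2) then g s(p.1, p.2) else 0),
    ← Finset.sum_filter]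
  have hinj : Set.InjOn (fun p : HexVertex × HexVertex => s(p.1, p.2))
      ↑(((((Λ.filter fun v => v.2 = 0) ×ˢ Λ).filter fun p => hexGraph.Adj p.1 p.2)).filter fun p => P s(p.1, p.2)) :=
    (injOn_sym2_pairFinset Λ).mono (by
      intro p hp
      rw [Finset.mem_coe, Finset.mem_filter] at hp
      exact hp.1)
  rw [← Finset.sum_image (f := g) hinj]
  refine Finset.sum_le_sum_of_subset_of_nonneg ?_ fun e _ _ => hg e
  intro e he
  rw [Finset.mem_image] at he
  obtain ⟨p, hp, rfl⟩ := he
  rw [Finset.mem_filter, mem_pairFinset] at hp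
  rw [Set.Finite.mem_toFinset]
  exact ⟨⟨(SimpleGraph.mem_edgeSet _).2 hp.1.2.2.2, p.1, Sym2.mem_mk_left _ _, hp.1.1⟩, hp.2⟩


/-! ### Metric bookkeeping at scale `δ` -/

/-- A point within `r` of the support lands in the `r`-thickening. [folklore] -/
theorem mem_of_dist_le_of_mem_tsupport {ψ : ℂ → ℂ} {K₁ : Set ℂ} {r : ℝ}
    (hK : cthickening r (tsupport ψ) ⊆ K₁) {x y : ℂ} (hy : y ∈ tsupport ψ) (hxy : dist x y ≤ r) :
    x ∈ K₁ :=
  hK (mem_cthickening_of_dist_le x y r _ hy hxy)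

/-- The rescaled mid-edge is within `δ/2` of the rescaled black end. [folklore] -/
theorem dist_mid_center_le {δ : ℝ} (hδ : 0 ≤ δ) {v t : HexVertex} (h : hexGraph.Adj v t) :
    dist ((δ : ℂ) * hexMidpoint s(v, t)) ((δ : ℂ) * hexCenter v) ≤ δ / 2 := by
  rw [dist_eq_norm, ← mul_sub, norm_mul, Complex.norm_real, Real.norm_of_nonneg hδ]
  have := norm_hexMidpoint_sub_hexCenter_le h
  nlinarith

/-- The rescaled mid-edge is within `δ/2` of the rescaled white end. [folklore] -/
theorem dist_mid_center_le' {δ : ℝ} (hδ : 0 ≤ δ) {v t : HexVertex} (h : hexGraph.Adj v t) :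
    dist ((δ : ℂ) * hexMidpoint s(v, t)) ((δ : ℂ) * hexCenter t) ≤ δ / 2 := by
  rw [dist_comm, dist_eq_norm, ← mul_sub, norm_mul, Complex.norm_real, Real.norm_of_nonneg hδ]
  have := norm_hexCenter_sub_hexMidpoint_le h
  nlinarith

end Summit.CriticalPhenomena.SAWScalingLimit.Theorems.ConjugateClassNegligibleSynthesis
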